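import Literature.NumberTheory.LFunctions.ConreyIwaniec2020LacunaryCriticalZeros
import Literature.NumberTheory.QuadraticFields.QuadraticDedekindZeta
import Literature.NumberTheory.LFunctions.RealZeroEffectiveRepulsionExplicitII
import Literature.Barriers.Parity.SiegelZeroDichotomy
import HarnessLib

/-!
# A Siegel zero of quality `η` makes Conrey–Iwaniec's defect `N(T) − N₀₀(T)` for class group
# `L`-functions small: `≤ C(T log q + (log q · log T/η)^{1/4} T log T)` (PROVED only; debt 0)

Topic `Literature/NumberTheory/LFunctions`. Typed for the cell `parity-realchar` (SIEGEL INSTRUMENT,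
deliverable (3) «illusory-world conditionals», topic I.10 «zero spacing / Deuring's vertical
phenomenon»): a PROVED reading of the `landau-siegel` cell's named fact `conreyIwaniec2020_theorem21`
(Conrey–Iwaniec, Acta Arith. 195 (2020) Thm 2.1: for a class group `L`-function `L(s,ψ)` of the
quadratic field `K`, `N(T) ≤ N₀₀(T) + C(T log|D| + (L(1,χ) log T)^{1/4} T log T)`, `χ` the Kronecker
character of `K`) on the column's ZERO-side predicate.

The fact is stated in `L(1)`-currency ("`ε`-exceptional": `L(1,χ) log|D| ≤ ε`). For `K` with ODD
discriminant `d_K`, `q = |d_K| ≥ 232`, the Kronecker character is the tree's `jacobiChar q`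
(`Quadratic.dedekindZeta_eq_riemannZeta_mul_LSeries`: `ζ_K = ζ·L(s, jacobiChar q)` on `Re s > 1`;
`jacobiChar_natAbs_discr_ne_one`), and a Tao–Teräväinen Siegel zero of quality `η ≥ 40` attached to it
gives `L(1,χ) ≤ log q/η` by the kernel's explicit Montgomery–Vaughan (11.10)
(`RealZeroRepulsion.isSiegelZero_eta_le_log_sq_div`). Substituting:

* `IsSiegelZero.classGroup_zeroCount_le` — for every class group character `ψ` of `K` and `T ≥ 2`:
  `N(T) ≤ N₀₀(T) + C·(T log q + (log q · log T/η)^{1/4}·T log T)` with Conrey–Iwaniec's absolute `C`;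
  i.e. all but `O(T log q + (log q log T/η)^{1/4} T log T)` of the zeros of `L(s,ψ)` at height `∼ T` are
  SIMPLE and ON THE CRITICAL LINE — the defect's second term decays like `η^{−1/4}` in the quality.

LABEL: instrument / kernel glue (I.10 reading); no claim that a Siegel zero exists; nothing about the
size of `N(T)` itself (the tree has no `N(T) ≍ T log(qT)` for class group `L`-functions, so the
"100 %" form (2.3) is not derived here).

## References

* [ConreyIwaniec2020] J. B. Conrey, H. Iwaniec, Acta Arith. 195 (2020) 217–268, Theorem 2.1 (2.2)
  (tree fact `conreyIwaniec2020_theorem21`, typed by the cell `landau-siegel`).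
* [MontgomeryVaughan2007] Theorem 11.4 (11.10) (explicit upper half, tree).
* [NeukirchANT1999] Ch. VII §5 / Ch. I §8 (ζ_K = ζ·L(χ_{d_K}) for quadratic `K`, as proved in the tree).
* [TaoTeravainen2021] Definition 1.4 (`IsSiegelZero`).
-/

noncomputable section

open Literature.Barriers.Parity
open Literature.NumberTheory.QuadraticFields Literature.NumberTheory.QuadraticFields.Quadratic
open _root_.NumberField Module

namespace Literature.NumberTheory.LFunctions

open ConreyIwaniec2020

variable {K : Type} [Field K] [NumberField K]

/-- **Conrey–Iwaniec's Theorem 2.1 under a Siegel zero** (PROVED modulo the named fact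
`conreyIwaniec2020_theorem21`): `K` quadratic with odd discriminant, `q = |d_K| ≥ 232`, and the
Kronecker character `jacobiChar q` carrying a Tao–Teräväinen Siegel zero of quality `η ≥ 40`; then for
every class group character `ψ` and `T ≥ 2`,
`N(T) ≤ N₀₀(T) + C·(T log q + (log q · log T/η)^{1/4} T log T)` (Conrey–Iwaniec's absolute `C`; `N`,
`N₀₀` the dyadic counts of all zeros / simple critical zeros of `L(s,ψ)` at height `T < γ ≤ 2T`).
[cite: ConreyIwaniec2020, Theorem 2.1 (2.2)] [cite: MontgomeryVaughan2007, Theorem 11.4 (11.10)]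
[cite: TaoTeravainen2021, Definition 1.4] -/
theorem _root_.Literature.Barriers.Parity.IsSiegelZero.classGroup_zeroCount_le
    (hCI : conreyIwaniec2020_theorem21) :
    ∃ C : ℝ, ∀ (K : Type) [Field K] [NumberField K], finrank ℚ K = 2 →
      Odd (NumberField.discr K) → 232 ≤ (NumberField.discr K).natAbs →
      ∀ η : ℝ, IsSiegelZero (jacobiChar (NumberField.discr K).natAbs) η → 40 ≤ η →
      ∀ (ψ : ClassGroup (𝓞 K) →* ℂˣ) (T : ℝ), 2 ≤ T →
        (dyadicZeroCount (NumberField.classGroupLFunction K ψ) T : ℝ) ≤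
          dyadicSimpleCriticalZeroCount (NumberField.classGroupLFunction K ψ) T +
            C * (T * Real.log (NumberField.discr K).natAbs +
              (Real.log (NumberField.discr K).natAbs * Real.log T / η) ^ (1 / 4 : ℝ) *
                T * Real.log T) := by
  obtain ⟨C, hC⟩ := hCI
  -- Conrey–Iwaniec's `C` may be taken `≥ 0` (the bound with `max C 0` is weaker)
  refine ⟨max C 0, fun K _ _ h2 hodd hq η hS h40 ψ T hT => ?_⟩
  set q : ℕ := (NumberField.discr K).natAbs with hqdef
  have hκ1 : jacobiChar q ≠ 1 := jacobiChar_natAbs_discr_ne_one h2 hodd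
  have hζ : ∀ s : ℂ, 1 < s.re →
      NumberField.dedekindZeta K s = riemannZeta s * LSeries (fun n ↦ jacobiChar q n) s :=
    fun s hs => dedekindZeta_eq_riemannZeta_mul_LSeries h2 hodd hs
  have hmain := hC K h2 q (jacobiChar q) rfl hκ1 hζ ψ T hT
  -- the `L(1)` side from the zero side: `‖L(1,χ)‖ ≤ log q/η`
  have hL := RealZeroRepulsion.isSiegelZero_eta_le_log_sq_div hq hS h40
  have hq1 : (1 : ℝ) < q := by exact_mod_cast (show 1 < q by omega)
  have hlogq : 0 < Real.log q := Real.log_pos hq1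
  have hη : 0 < η := by linarith
  have hL1 : ‖(jacobiChar q).LFunction 1‖ ≤ Real.log q / η := by
    rw [le_div_iff₀ hη]
    have h' : ‖(jacobiChar q).LFunction 1‖ * Real.log q * η ≤ Real.log q ^ 2 := by
      have := mul_le_mul_of_nonneg_right hL hη.le
      rwa [div_mul_cancel₀ _ hη.ne'] at this
    nlinarith [norm_nonneg ((jacobiChar q).LFunction 1)]
  have hlogT : 0 < Real.log T := Real.log_pos (by linarith)
  have hT0 : 0 < T := by linarith
  -- monotonicity of the error term in `‖L(1,χ)‖` and in `C`
  have hpow : (‖(jacobiChar q).LFunction 1‖ * Real.log T) ^ (1 / 4 : ℝ) ≤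
      (Real.log q * Real.log T / η) ^ (1 / 4 : ℝ) := by
    apply Real.rpow_le_rpow (by positivity)
    · have := mul_le_mul_of_nonneg_right hL1 hlogT.le
      calc ‖(jacobiChar q).LFunction 1‖ * Real.log T ≤ Real.log q / η * Real.log T := this
        _ = Real.log q * Real.log T / η := by ring
    · norm_num
  have hE0 : 0 ≤ T * Real.log q +
      (Real.log q * Real.log T / η) ^ (1 / 4 : ℝ) * T * Real.log T := by positivity
  have hE : T * Real.log q + (‖(jacobiChar q).LFunction 1‖ * Real.log T) ^ (1 / 4 : ℝ) * T * Real.log T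
      ≤ T * Real.log q + (Real.log q * Real.log T / η) ^ (1 / 4 : ℝ) * T * Real.log T := by
    have := mul_le_mul_of_nonneg_right (mul_le_mul_of_nonneg_right hpow hT0.le) hlogT.le
    linarith
  have hE0' : 0 ≤ T * Real.log q +
      (‖(jacobiChar q).LFunction 1‖ * Real.log T) ^ (1 / 4 : ℝ) * T * Real.log T := by positivity
  calc (dyadicZeroCount (NumberField.classGroupLFunction K ψ) T : ℝ)
      ≤ dyadicSimpleCriticalZeroCount (NumberField.classGroupLFunction K ψ) T +
          C * (T * Real.log q +
            (‖(jacobiChar q).LFunction 1‖ * Real.log T) ^ (1 / 4 : ℝ) * T * Real.log T) := hmain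
    _ ≤ dyadicSimpleCriticalZeroCount (NumberField.classGroupLFunction K ψ) T +
          max C 0 * (T * Real.log q +
            (‖(jacobiChar q).LFunction 1‖ * Real.log T) ^ (1 / 4 : ℝ) * T * Real.log T) := by
        gcongr
        exact le_max_left _ _
    _ ≤ dyadicSimpleCriticalZeroCount (NumberField.classGroupLFunction K ψ) T +
          max C 0 * (T * Real.log q +
            (Real.log q * Real.log T / η) ^ (1 / 4 : ℝ) * T * Real.log T) := by
        gcongr

end Literature.NumberTheory.LFunctions

end
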